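import Mathlib
import Summits.QuantumFields.BalabanUV.Beta.AnalyticWalkSum216
import Summits.QuantumFields.BalabanUV.Beta.DecouplingSupport110

/-!
# [Balaban1988RG2Cluster] (2.16) p. 16 ∕ p. 13 «The parameters s(Δ), Δ∈σ₀, are introduced into the operators as before»:
# for MONOMIALLY DECORATED walk terms the per-term analyticity hypothesis of `AnalyticWalkSum216` is AUTOMATIC, so the
# (2.16)-shape bound follows from the MAJORANT DATA ALONE — terminal leaf (T1)(i)'s σ-analyticity clause ⇐ (ii) in the
# walk model (cell topic `Summits/QuantumFields/BalabanUV/Beta`; row-D4 apex map, census §10.13)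

HONEST FRAMING (cell rule).  Discharging `BetaPertH` makes Bałaban's UV stability UNCONDITIONAL — a real
constructive-QFT result; NOT the continuum limit, NOT the Clay problem.  This module discharges NOTHING of `BetaPertH`.
It is a bookkeeping corollary of two tree modules of this lineage: `AnalyticWalkSum216` (gen 32, p202633∕p203182) reduced
terminal leaf (T1) G-B13-05a (the smallness (2.16) of the complexified localised operators) to PER-TERM data — (i) each
walk term analytic in the complex parameter `σ` on a disc, (ii) a `σ`-uniform entrywise majorant with summable LOCALISED
row sums — and `DecouplingHolomorphy110` (gen 35, p205550) observed that the `s`-decoration of [II] multiplies each walk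
term by a MONOMIAL in the parameters.  Print says the §2 operators behind (2.14)–(2.16) are decorated the same way
(p. 13).  For such terms (i) is automatic and (ii) follows from a bound on the undecorated kernels weighted by
`r^{(degree)}`; hence, in the walk model, (T1) = its clause (ii) = the x-uniform (3.108)-type majorant that terminal leaf
(T2) G-IF-10 owes — ONE estimate, not two.  Records-level consequence only; NO class change on (T2)∕(T3).  NOT summit
progress.  Unit `b2b-balaban-beta-an4-g35` (owner of `BINDER-OWNERS.md` row D4); cell `GAPS.md` C-an4-76.

CITATION HEADER (lean-in-tree rule).  [II] = T. Bałaban, *Renormalization group approach to lattice gauge field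
theories. II. Cluster expansions*, Commun. Math. Phys. **116**, 1–22 (1988) [Balaban1988RG2Cluster] (journal page =
PDF page; renders `HOME/b2b-balaban-ref1/pages/1988-cmp116-rg-II-cluster/…-p003-x2.png`, `…-p013-x2.png`,
`…-p016-x2.png`, READ AS IMAGES by this unit before writing).  p. 3 [PDF 3], verbatim: *"for a random walk ω localized
in X̃₀⁵ ∪ X̃₁⁵ ∪ ⋯ ∪ X̃_n⁵ we take the {Δ₁, …, Δ_m} of all cubes from σ₀ which intersect this localization domain, and
we multiply the term in (1.6) corresponding to ω by s(Δ₁)⋯s(Δ_m). This way the s-dependent propagators H(s), G̃(s),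
H₀(s) are defined."*; p. 13 [PDF 13], verbatim: *"We localize it again by the method used in Sect. 1, introducing the
parameters s and differentiating. … The parameters s(Δ), Δ∈σ₀, are introduced into the operators as before, but the
generalized random expansions are constructed now in a slightly different way."* and *"Using these expansions we
introduce the parameters s, and we apply the"* [p. 14 l. 1: *"decomposition (1.10),"*]; p. 16 [PDF 16], verbatim:
*"|R₁(b, b′)| ≦ (O(1)e^{−1∕3δ₀M} + O(α₀ + α₁))exp(−½δ₀|b₋ − b′₋|). (2.16)"*.

WHAT IS CERTIFIED HERE (kernel, sorry-free; [folklore]; one complex coordinate `σ` at a time, the others frozen inside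
the polydisc, exactly as in `AnalyticWalkSum216` and `DecouplingHolomorphy110`).
§1 `monoTerm a e K w σ := (a_w · σ^{e_w}) • K_w` — a walk term decorated by a monomial in the free coordinate (`a_w` =
   the product of the frozen coordinates met by the walk, `e_w` = the multiplicity of the free one; products of
   decorated operators, as in (2.14)'s `Γ_k`, give `e_w ≥ 2`); **`differentiableOn_monoTerm`** — hypothesis (i) `ha` of
   `AnalyticWalkSum216.wrs_termSum_sub` holds on EVERY set, with no assumption; `norm_monoTerm_le` — hypothesis (ii) `hm`
   on the disc `‖σ‖ < r` from `‖a_w‖·r^{e_w} ≤ c_w` with the majorant `m_w(i,j) := c_w‖K_w(i,j)‖`.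
§2 ENDs **`wrs_termSum_sub_monomial`** and **`wrs_inv_termSum_sub_monomial`**: the (2.16)-shape bounds of
   `AnalyticWalkSum216` for the difference `A(σ) − A(0)` and for the inverses, from the MAJORANT DATA ONLY (summable
   `c_w‖K_w(i,j)‖`, termwise localised row sums `Σ_j c_w‖K_w(i,j)‖e^{κd(i,j)} ≤ ρ_w`, `Σ_w ρ_w ≤ ρ`) — BY NAME.
§3 THE BRIDGE to the siblings' decoration: `weight_update_eq` — the decoupling weight `∏_{Δ∈cubes ω∖R} s(Δ)` of
   `DecouplingSupport110` with one coordinate free IS such a monomial (`e ∈ {0,1}`), and `norm_frozen_mul_le` bounds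
   (frozen factor)·`r^e` by `r^{m(ω)}` on the polydisc (`r ≥ 1`) — so a product of `k` decorated propagators has terms `monoTerm` with
   `e_w ≤ k` and `‖a_w‖r^{e_w} ≤ r^{Σ m(ω_i)}`.

v1.0.1 (DOCSTRING-ONLY, gen 37, same lineage; every declaration byte-identical): CURRENCY CAVEAT — §2's ENDs take
TERMWISE constants `Σ_w ρ_w ≤ ρ`, which are VOLUME-DEPENDENT on translation-covariant walk families (every walk
counted once); the VOLUME-FREE forms (summed majorant with localised rows, the hypotheses of
`AnalyticWalkSum216.wrs_termSum_sub`) are `AnalyticWalkSum216RowMonoData.wrs_termSum_sub_monomial'`∕`rowData_monoTerm`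
(owner XREAD C-an4-89 (f); census `BETA/REMAINDER-BETA.md` §10.23).
NOT CLAIMED.  Any walk expansion of Bałaban's operators, any majorant ((1.7), (1.11), (3.108) [13] — terminal leaves
(T2)∕(T3)), the identification of `κ, d` with `½δ₀, |b₋ − b′₋|`, the (𝐔, 𝐉)-analyticity of the walk terms (B9-side
BR), joint analyticity; NO class change on any GAPS row; NOT summit progress.
-/

namespace Summit.QuantumFields.BalabanUV.Beta.AnalyticWalkSum216Monomial

open Metric Set
open Literature.MathematicalPhysics.QuantumFieldTheory.Balaban1983to89
open Literature.MathematicalPhysics.QuantumFieldTheory.Balaban1983to89.B14DomainGeom (Pt)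
open B13PerturbativeStep (WRS WeightHyp)
open Summit.QuantumFields.BalabanUV.Beta.AnalyticWalkSum216 (termSum majSum wrs_termSum_sub_of_termwise
  wrs_inv_termSum_sub majSum_row_le_of_termwise)
open Summit.QuantumFields.BalabanUV.Beta.DecouplingSupport110 (weight)

noncomputable section

variable {n : Type*} [Fintype n] {W : Type*}

/-! ## §1 Monomially decorated walk terms: (i) is automatic, (ii) from the weighted kernel bound -/

/-- A walk term decorated by a MONOMIAL in the free complex coordinate: `(a_w · σ^{e_w}) • K_w` ([II] p. 3: the term of
`ω` multiplied by `s(Δ₁)⋯s(Δ_m)`; p. 13: *"introduced into the operators as before"*). [cite: Balaban1988RG2Cluster, p.13 before (2.7)] -/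
def monoTerm (a : W → ℂ) (e : W → ℕ) (K : W → Matrix n n ℂ) : W → ℂ → Matrix n n ℂ :=
  fun w σ => (a w * σ ^ e w) • K w

omit [Fintype n] in
/-- Entries of a monomial term. [folklore] -/
@[simp] theorem monoTerm_apply (a : W → ℂ) (e : W → ℕ) (K : W → Matrix n n ℂ) (w : W) (σ : ℂ) (i j : n) :
    monoTerm a e K w σ i j = (a w * σ ^ e w) * K w i j := by
  simp [monoTerm, Matrix.smul_apply]

omit [Fintype n] in
/-- **(i) IS AUTOMATIC**: every entry of a monomially decorated walk term is a polynomial in `σ`, hence complex-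
differentiable on every set — the hypothesis `ha` of `AnalyticWalkSum216.wrs_termSum_sub` needs no input. [folklore] -/
theorem differentiableOn_monoTerm (a : W → ℂ) (e : W → ℕ) (K : W → Matrix n n ℂ) (U : Set ℂ) :
    ∀ w i j, DifferentiableOn ℂ (fun σ => monoTerm a e K w σ i j) U := by
  intro w i j
  simp only [monoTerm_apply]
  exact ((differentiableOn_const _).mul (differentiableOn_id.pow _)).mul (differentiableOn_const _)

omit [Fintype n] in
/-- **(ii) FROM THE WEIGHTED KERNEL BOUND**: on the disc `‖σ‖ < r`, if the frozen factor obeys `‖a_w‖·r^{e_w} ≤ c_w`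
(for the decoupling weights: `c_w = r^{m(ω)}`, §3), then `‖monoTerm‖ ≤ c_w·‖K_w(i,j)‖` entrywise — the `σ`-UNIFORM
majorant `hm` of `AnalyticWalkSum216`. [folklore] -/
theorem norm_monoTerm_le {a : W → ℂ} {e : W → ℕ} {c : W → ℝ} {r : ℝ} (hc : ∀ w, ‖a w‖ * r ^ e w ≤ c w)
    (K : W → Matrix n n ℂ) : ∀ w, ∀ σ ∈ ball (0 : ℂ) r, ∀ i j, ‖monoTerm a e K w σ i j‖ ≤ c w * ‖K w i j‖ := by
  intro w σ hσ i j
  rw [monoTerm_apply, norm_mul, norm_mul, norm_pow]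
  have hσ' : ‖σ‖ ≤ r := (mem_ball_zero_iff.1 hσ).le
  have h1 : ‖a w‖ * ‖σ‖ ^ e w ≤ c w :=
    (mul_le_mul_of_nonneg_left (pow_le_pow_left₀ (norm_nonneg _) hσ' _) (norm_nonneg _)).trans (hc w)
  exact mul_le_mul_of_nonneg_right h1 (norm_nonneg _)

/-! ## §2 ENDs: the (2.16)-shape bounds from the MAJORANT DATA ONLY -/

/-- **(T1) ⇐ (ii) FOR MONOMIALLY DECORATED WALK EXPANSIONS** (kernel END; `AnalyticWalkSum216.wrs_termSum_sub_of_termwise`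
BY NAME with (i) supplied by `differentiableOn_monoTerm`): summable weighted kernel majorants `c_w‖K_w(i,j)‖` with
TERMWISE localised row sums `Σ_j c_w‖K_w(i,j)‖e^{κd(i,j)} ≤ ρ_w`, `Σ_w ρ_w ≤ ρ`, give the (2.16)-shape bound
`WRS κ d (A(σ) − A(0)) (2ρ∕r·|σ|)` for the summed decorated operator on the disc `‖σ‖ < r`.
[cite: Balaban1988RG2Cluster, (2.16) p.16] -/
theorem wrs_termSum_sub_monomial {a : W → ℂ} {e : W → ℕ} {c : W → ℝ} {r : ℝ} (hr : 0 < r)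
    (hc : ∀ w, ‖a w‖ * r ^ e w ≤ c w) {K : W → Matrix n n ℂ} {κ : ℝ} {d : n → n → ℝ} {ρw : W → ℝ} {ρ : ℝ}
    (hsum : ∀ i j, Summable fun w => c w * ‖K w i j‖)
    (hrow : ∀ w i, ∑ j, c w * ‖K w i j‖ * Real.exp (κ * d i j) ≤ ρw w) (hρw : Summable ρw) (hρ : ∑' w, ρw w ≤ ρ)
    {σ : ℂ} (hσ : σ ∈ ball (0 : ℂ) r) :
    WRS κ d (termSum (monoTerm a e K) σ - termSum (monoTerm a e K) 0) (2 * ρ / r * ‖σ‖) :=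
  wrs_termSum_sub_of_termwise (m := fun w i j => c w * ‖K w i j‖) hr (differentiableOn_monoTerm a e K _)
    (norm_monoTerm_le hc K) hsum hrow hρw hρ hσ

/-- **«R₂ satisfying (2.16)» for the INVERSES of a monomially decorated walk expansion, from the majorant data only**
(`AnalyticWalkSum216.wrs_inv_termSum_sub` BY NAME; (i) automatic). [cite: Balaban1988RG2Cluster, (2.16)–(2.17) p.16] -/
theorem wrs_inv_termSum_sub_monomial [DecidableEq n] {a : W → ℂ} {e : W → ℕ} {c : W → ℝ} {r : ℝ} (hr : 0 < r)
    (hc : ∀ w, ‖a w‖ * r ^ e w ≤ c w) {K : W → Matrix n n ℂ} {κ : ℝ} {d : n → n → ℝ} (hw : WeightHyp κ d)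
    {ρw : W → ℝ} {ρ Kc : ℝ} (hsum : ∀ i j, Summable fun w => c w * ‖K w i j‖)
    (hrow : ∀ w i, ∑ j, c w * ‖K w i j‖ * Real.exp (κ * d i j) ≤ ρw w) (hρw : Summable ρw) (hρ : ∑' w, ρw w ≤ ρ)
    (hM : IsUnit (termSum (monoTerm a e K) 0)) (hK : WRS κ d (termSum (monoTerm a e K) 0)⁻¹ Kc)
    {σ : ℂ} (hσ : σ ∈ ball (0 : ℂ) r) (hsmall : Kc * (2 * ρ / r * ‖σ‖) < 1) :
    WRS κ d ((termSum (monoTerm a e K) σ)⁻¹ - (termSum (monoTerm a e K) 0)⁻¹)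
      (Kc * (2 * ρ / r * ‖σ‖) * (1 - Kc * (2 * ρ / r * ‖σ‖))⁻¹ * Kc) :=
  wrs_inv_termSum_sub (m := fun w i j => c w * ‖K w i j‖) hw hr (differentiableOn_monoTerm a e K _)
    (norm_monoTerm_le hc K) hsum (majSum_row_le_of_termwise hsum hrow hρw hρ) hM hK hσ hsmall

/-! ## §3 The bridge: the decoupling weight with one coordinate free IS a monomial with a frozen factor ≤ r^{m(ω)−e} -/

section Bridge

variable {dd : ℕ} {Ω : Type*}

/-- The FROZEN FACTOR of the decoupling weight of a walk when the coordinate `i` is free: the product of the other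
parameters met by the walk. [folklore] -/
def frozen (R : Finset (Pt dd)) (cubes : Ω → Finset (Pt dd)) (o : Ω) (i : Pt dd) (τ : Pt dd → ℂ) : ℂ :=
  ∏ Δ ∈ (cubes o \ R).erase i, τ Δ

/-- The MULTIPLICITY of the free coordinate in the weight: `1` if the walk meets the cube `i` (outside `R`), else `0`
(the decoration multiplies by each parameter AT MOST ONCE — p. 3: the SET `{Δ₁, …, Δ_m}`). [cite: Balaban1988RG2Cluster, p.3 after (1.7)] -/
def mult (R : Finset (Pt dd)) (cubes : Ω → Finset (Pt dd)) (o : Ω) (i : Pt dd) : ℕ :=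
  if i ∈ cubes o \ R then 1 else 0

/-- **THE DECOUPLING WEIGHT WITH ONE COORDINATE FREE IS A MONOMIAL**: `weight(s|_{s(i)=z}) = frozen · z^{mult}`.
[folklore] -/
theorem weight_update_eq (R : Finset (Pt dd)) (cubes : Ω → Finset (Pt dd)) (o : Ω) (i : Pt dd) (τ : Pt dd → ℂ)
    (z : ℂ) : weight R cubes o (Function.update τ i z) = frozen R cubes o i τ * z ^ mult R cubes o i := by
  unfold weight frozen mult
  by_cases hi : i ∈ cubes o \ R
  · rw [Finset.prod_update_of_mem hi, if_pos hi, pow_one, mul_comm, Finset.sdiff_singleton_eq_erase]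
  · rw [Finset.prod_update_of_notMem hi, if_neg hi, pow_zero, mul_one, Finset.erase_eq_of_notMem hi]

/-- On the polydisc of radius `r ≥ 0`... more precisely for base points with `‖s(Δ)‖ ≤ r` and `1 ≤ r`: the frozen factor
times `r^{mult}` is bounded by `r^{m(ω)}`, `m(ω) = #(cubes ω ∖ R)` — so `norm_monoTerm_le` applies with `c_w = r^{m(ω)}`
(the `e^{mκ₁}` of (1.11) for `r = e^{κ₁}`). [cite: Balaban1988RG2Cluster, (1.11) p.5] -/
theorem norm_frozen_mul_le {r : ℝ} (hr : 1 ≤ r) (R : Finset (Pt dd)) (cubes : Ω → Finset (Pt dd)) (o : Ω) (i : Pt dd)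
    {τ : Pt dd → ℂ} (hτ : ∀ j, ‖τ j‖ ≤ r) :
    ‖frozen R cubes o i τ‖ * r ^ mult R cubes o i ≤ r ^ (cubes o \ R).card := by
  have h0 : 0 ≤ r := zero_le_one.trans hr
  have hfro : ‖frozen R cubes o i τ‖ ≤ r ^ ((cubes o \ R).erase i).card := by
    unfold frozen
    rw [norm_prod, ← Finset.prod_const]
    exact Finset.prod_le_prod (fun _ _ => norm_nonneg _) fun Δ _ => hτ Δ
  unfold mult
  by_cases hi : i ∈ cubes o \ R
  · rw [if_pos hi, pow_one]
    calc ‖frozen R cubes o i τ‖ * r ≤ r ^ ((cubes o \ R).erase i).card * r :=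
          mul_le_mul_of_nonneg_right hfro h0
      _ = r ^ (cubes o \ R).card := by
          rw [← pow_succ, Finset.card_erase_add_one hi]
  · rw [if_neg hi, pow_zero, mul_one, ← Finset.erase_eq_of_notMem hi]
    exact hfro

end Bridge

/-! ## §4 Non-vacuity -/

/-- The hypothesis set of `wrs_termSum_sub_monomial` is inhabited: one bond, one walk, `a = 1`, `e = 1`, `K = 1`, radius
`1`, `c = 1`, trivial distance, `ρ = 1`. [folklore] -/
example : WRS (n := Unit) 0 (fun _ _ => 0)
    (termSum (monoTerm (fun _ : Unit => (1 : ℂ)) (fun _ => 1) (fun _ => fun _ _ => (1 : ℂ))) (1 / 2)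
      - termSum (monoTerm (fun _ : Unit => (1 : ℂ)) (fun _ => 1) (fun _ => fun _ _ => (1 : ℂ))) 0)
    (2 * 1 / 1 * ‖(1 / 2 : ℂ)‖) := by
  refine wrs_termSum_sub_monomial (c := fun _ => (1 : ℝ)) (ρw := fun _ => (1 : ℝ)) one_pos (fun _ => by simp)
    (fun _ _ => .of_finite) (fun _ _ => by simp) .of_finite (by simp) ?_
  rw [mem_ball_zero_iff]; norm_num

end

end Summit.QuantumFields.BalabanUV.Beta.AnalyticWalkSum216Monomial
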